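import Literature.Analysis.PDE.InteriorL2Estimates
import Literature.Geometry.Lorentzian.HarmonicallyFlatProofs
import Literature.Analysis.Potential.NewtonFarField
import HarnessLib

/-!
# The pointwise bound by the `L²` norm of the Laplacian in dimension three, and the scaled
# interior maximum estimate

Analysis/PDE support file, continuation of `InteriorL2Estimates.lean` on the discharge path of
`Literature.Geometry.Lorentzian.exists_conformal_negativeMass_of_massZero` (Schoen–Yau,
Comm. Math. Phys. 65 (1979), Lemma 3.2 ⇒ Cor. 3.1). In dimension three the Newtonian kernel
`Γ(z) = -(4π|z|)⁻¹` is square integrable near its pole (`∫_{B_ρ} |z|⁻² dz = 4πρ`), so Green's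
representation `w = Γ ⋆ Δw` for `w ∈ C²_c(B̄(x₀,ρ))` (tree:
`eq_integral_newtonKernel_mul_laplacian`, `HarmonicallyFlatProofs.lean`) and the Cauchy–Schwarz
inequality give the pointwise bound

* `sq_le_mul_integral_sq_laplacian` — `w(x)² ≤ (3c₂/(16π²)) ρ ∫ (Δw)²`, `c₂ = ∫_{B₁}|u|⁻² du`;

combined with the cut-off product of `ball_energy_estimates` this is the scaled local maximum
estimate for classical solutions of equations close to the Laplacian:

* `ball_estimates_three` — there is `M ≥ 1` such that, whenever `u ∈ C³(U)`,
  `B̄(x₀,σ) ⊆ U` and `|Δu| ≤ ε √(Σᵢⱼ(∂ⱼ∂ᵢu)²) + (M/σ) √(Σᵢ(∂ᵢu)²) + (M/σ)² |u| + G` on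
  `B̄(x₀,σ)` (`0 ≤ ε ≤ 1/10`, `G` continuous), the `H¹(B_{σ/2})` and `H²(B_{σ/2})` energies and
  `sup_{B̄_{σ/2}} u²` are bounded by explicit multiples of `σ⁻²ᵏ ∫_{B̄_σ} u²` and `∫_{B̄_σ} G²`
  with the natural powers of `σ` (`sup_{B_{σ/2}} |u| ≲ σ^{-3/2}‖u‖_{L²(B_σ)} + σ^{1/2}‖G‖_{L²(B_σ)}`).

This is the form in which Schoen–Yau (proof of Lemma 3.2, pp. 65–71) use *"standard linear
theory [17, p. 161]"* to pass from the `L⁶` bound (3.5) to the decay of `v` and of its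
derivatives ((3.9), (3.19)–(3.20)); for smooth solutions no Moser iteration or Schauder theory
is needed. Everything is proved; no definitions and no named facts are introduced.

## References

* D. Gilbarg, N. S. Trudinger, *Elliptic partial differential equations of second order*
  (2001), (2.12)–(2.17), Thm. 8.17, Thm. 9.20. [GilbargTrudinger2001]
* R. Schoen, S.-T. Yau, Comm. Math. Phys. 65 (1979) 45–76, proof of Lemma 3.2, (3.5)–(3.9),
  (3.19)–(3.20). [SchoenYauPMT1979]
-/

noncomputable section

open MeasureTheory Set Filter Topology Real Metric Bornology
open scoped ENNReal Laplacian ContDiff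

namespace Literature.Analysis.PDE

open Literature.Analysis.FluidPDE Literature.Analysis.FluidPDE.RieszKernel
open Literature.Analysis.Potential
open Literature.Geometry.Lorentzian (E3 eq_integral_newtonKernel_mul_laplacian)

/-- Optimising Young's inequality: if `t ≤ κ a / 2 + b / (2κ)` for every `κ > 0` (`t, a, b ≥ 0`),
then `t² ≤ a b`. [folklore] -/
theorem sq_le_mul_of_forall_young {t a b : ℝ} (ht : 0 ≤ t) (ha : 0 ≤ a) (hb : 0 ≤ b)
    (h : ∀ κ : ℝ, 0 < κ → t ≤ κ / 2 * a + b / (2 * κ)) : t ^ 2 ≤ a * b := by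
  by_contra hlt
  push Not at hlt
  have ht0 : 0 < t := by
    rcases ht.lt_or_eq with h' | h'
    · exact h'
    · rw [← h'] at hlt; nlinarith
  rcases ha.lt_or_eq with ha' | ha'
  · -- `a > 0`: take `κ = t / a`
    have hκ : 0 < t / a := div_pos ht0 ha'
    have h1 := h (t / a) hκ
    have e : t / a / 2 * a + b / (2 * (t / a)) = t / 2 + a * b / (2 * t) := by
      field_simp
    rw [e] at h1
    have h2 : a * b / (2 * t) < t / 2 := by
      rw [div_lt_iff₀ (by positivity)]; nlinarith
    linarith
  · -- `a = 0`: take `κ = (b + 1) / t`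
    subst ha'
    have hκ : 0 < (b + 1) / t := div_pos (by linarith) ht0
    have h1 := h ((b + 1) / t) hκ
    have e : (b + 1) / t / 2 * 0 + b / (2 * ((b + 1) / t)) = b * t / (2 * (b + 1)) := by
      field_simp
      ring
    rw [e] at h1
    have h2 : b * t / (2 * (b + 1)) < t := by
      rw [div_lt_iff₀ (by positivity)]; nlinarith
    linarith

/-- The square of the Newtonian kernel: `Γ(z)² = (16π²)⁻¹ |z|⁻²` (also at `z = 0`). [folklore] -/
theorem newtonKernel_sq (z : E3) : newtonKernel z ^ 2 = (16 * π ^ 2)⁻¹ * ‖z‖ ^ (-2 : ℝ) := by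
  rw [newtonKernel_eq, Real.rpow_neg (norm_nonneg _), Real.rpow_two]
  by_cases hz : ‖z‖ = 0
  · rw [hz]; simp
  · field_simp
    ring

/-- `∫_{B(x,R)} |x - y|⁻² dy = c₂ R` on `ℝ³`, with `c₂ = ∫_{B₁} |u|⁻²`. [folklore] -/
theorem integral_ball_norm_sub_rpow_neg_two (x : E3) {R : ℝ} (hR : 0 < R) :
    ∫ y in ball x R, ‖x - y‖ ^ (-2 : ℝ) =
      R * (∫⁻ u in ball (0 : E3) 1, powKer 2 u).toReal := by
  have hmeas : AEStronglyMeasurable (fun y : E3 ↦ ‖x - y‖ ^ (-2 : ℝ))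
      (volume.restrict (ball x R)) :=
    ((measurable_id.const_sub x).norm.pow_const _).aestronglyMeasurable
  rw [integral_eq_lintegral_of_nonneg_ae (Eventually.of_forall fun y ↦ Real.rpow_nonneg
    (norm_nonneg _) _) hmeas]
  have hlin : ∫⁻ y in ball x R, ENNReal.ofReal (‖x - y‖ ^ (-2 : ℝ)) =
      ∫⁻ y in ball (0 : E3) R, powKer 2 y := by
    have e : ∀ y : E3, ENNReal.ofReal (‖x - y‖ ^ (-2 : ℝ)) = powKer 2 (y - x) := fun y ↦ by
      rw [powKer_apply, norm_sub_rev]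
    simp_rw [e]
    exact setLIntegral_ball_comp_sub (powKer 2) x R
  rw [hlin, setLIntegral_ball_powKer_two hR, ENNReal.toReal_ofReal]
  exact mul_nonneg hR.le ENNReal.toReal_nonneg

/-- `y ↦ |x - y|⁻²` is integrable on balls of `ℝ³`. [folklore] -/
theorem integrableOn_ball_norm_sub_rpow_neg_two (x : E3) (R : ℝ) :
    IntegrableOn (fun y : E3 ↦ ‖x - y‖ ^ (-2 : ℝ)) (ball x R) := by
  have hmeas : AEStronglyMeasurable (fun y : E3 ↦ ‖x - y‖ ^ (-2 : ℝ)) volume :=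
    ((measurable_id.const_sub x).norm.pow_const _).aestronglyMeasurable
  refine ⟨hmeas.restrict, ?_⟩
  rw [hasFiniteIntegral_iff_ofReal (Eventually.of_forall fun y ↦ Real.rpow_nonneg
    (norm_nonneg _) _)]
  have e : ∀ y : E3, ENNReal.ofReal (‖x - y‖ ^ (-2 : ℝ)) = powKer 2 (y - x) := fun y ↦ by
    rw [powKer_apply, norm_sub_rev]
  simp_rw [e]
  rw [setLIntegral_ball_comp_sub (powKer 2) x R]
  exact lintegral_ball_powKer_lt_top (by norm_num) R

/-- **Pointwise bound through the `L²` norm of the Laplacian on `ℝ³`.** If `w ∈ C²(ℝ³)` is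
supported in the closed ball `B̄(x₀, ρ)`, then for every `x`,
`w(x)² ≤ (3 c₂ /(16π²)) ρ ∫ (Δw)²` with `c₂ = ∫_{B₁} |u|⁻² du` (`= 4π`). Green's representation
`w(x) = ∫ Γ(x - y) Δw(y) dy` and the Cauchy–Schwarz inequality over the ball `B(x, 3ρ) ⊇ supp w`,
where `∫_{B(x,3ρ)} Γ(x - y)² dy = 3ρ c₂/(16π²)` (the Newtonian kernel is square integrable near
its pole in dimension three). [folklore] -/
theorem sq_le_mul_integral_sq_laplacian {w : E3 → ℝ} (hw : ContDiff ℝ 2 w) {x₀ : E3} {ρ : ℝ}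
    (hρ : 0 < ρ) (hsupp : tsupport w ⊆ closedBall x₀ ρ) (x : E3) :
    w x ^ 2 ≤ 3 * (∫⁻ u in ball (0 : E3) 1, powKer 2 u).toReal / (16 * π ^ 2) * ρ
      * ∫ y, ((Δ w) y) ^ 2 := by
  set c₂ : ℝ := (∫⁻ u in ball (0 : E3) 1, powKer 2 u).toReal with hc₂
  have hc₂0 : 0 ≤ c₂ := ENNReal.toReal_nonneg
  have hwc : HasCompactSupport w :=
    IsCompact.of_isClosed_subset (isCompact_closedBall x₀ ρ) (isClosed_tsupport w) hsupp
  have hΔc : Continuous (Δ w) := continuous_laplacian hw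
  have hΔ0 : ∀ y ∉ tsupport w, (Δ w) y = 0 := fun y hy ↦ laplacian_eq_zero_of_notMem_tsupport hy
  have hJ0 : 0 ≤ ∫ y, ((Δ w) y) ^ 2 := integral_nonneg fun y ↦ sq_nonneg _
  by_cases hx : x ∈ tsupport w
  swap
  · rw [image_eq_zero_of_notMem_tsupport hx]
    simp only [ne_eq, OfNat.ofNat_ne_zero, not_false_eq_true, zero_pow]
    positivity
  -- Green's representation
  have hS : ∀ y : E3, ‖x₀‖ + ρ < ‖y‖ → (Δ w) y = 0 := by
    intro y hy
    refine hΔ0 y fun hmem ↦ ?_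
    have h1 : dist y x₀ ≤ ρ := mem_closedBall.1 (hsupp hmem)
    have h2 : ‖y‖ ≤ ‖y - x₀‖ + ‖x₀‖ := norm_le_norm_sub_add y x₀
    rw [dist_eq_norm] at h1
    linarith
  have hw0 : Tendsto w (cobounded E3) (𝓝 0) := by
    have hev : ∀ᶠ y in cobounded E3, w y = 0 := by
      have hb : (tsupport w)ᶜ ∈ cobounded E3 := hwc.isBounded
      filter_upwards [hb] with y hy using image_eq_zero_of_notMem_tsupport hy
    exact tendsto_const_nhds.congr' (hev.mono fun y hy ↦ hy.symm)
  have hrep := eq_integral_newtonKernel_mul_laplacian hw hS hw0 x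
  -- localise to the ball `B = B(x, 3ρ)`
  set R : ℝ := 3 * ρ with hR
  have hRpos : 0 < R := by rw [hR]; positivity
  have hxB : x ∈ closedBall x₀ ρ := hsupp hx
  have hsuppB : tsupport w ⊆ ball x R := by
    intro y hy
    have h1 : dist y x₀ ≤ ρ := mem_closedBall.1 (hsupp hy)
    have h2 : dist x x₀ ≤ ρ := mem_closedBall.1 hxB
    rw [mem_ball]
    calc dist y x ≤ dist y x₀ + dist x₀ x := dist_triangle _ _ _
      _ ≤ ρ + ρ := by rw [dist_comm x₀ x]; exact add_le_add h1 h2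
      _ < R := by rw [hR]; linarith
  have hloc : ∫ y, newtonKernel (x - y) * (Δ w) y =
      ∫ y in ball x R, newtonKernel (x - y) * (Δ w) y := by
    refine (setIntegral_eq_integral_of_forall_compl_eq_zero fun y hy ↦ ?_).symm
    rw [hΔ0 y fun h ↦ hy (hsuppB h), mul_zero]
  -- integrability on the ball
  have hI1 : IntegrableOn (fun y ↦ newtonKernel (x - y) ^ 2) (ball x R) := by
    have h : IntegrableOn (fun y ↦ (16 * π ^ 2)⁻¹ * ‖x - y‖ ^ (-2 : ℝ)) (ball x R) :=
      (integrableOn_ball_norm_sub_rpow_neg_two x R).const_mul (16 * π ^ 2)⁻¹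
    exact IntegrableOn.congr_fun h (fun y _ ↦ (newtonKernel_sq (x - y)).symm) measurableSet_ball
  have hI2' : Integrable fun y ↦ ((Δ w) y) ^ 2 :=
    (hΔc.pow 2).integrable_of_hasCompactSupport
      (HasCompactSupport.intro hwc fun y hy ↦ by simp [hΔ0 y hy])
  have hI2 : IntegrableOn (fun y ↦ ((Δ w) y) ^ 2) (ball x R) := hI2'.integrableOn
  have hKm : AEStronglyMeasurable (fun y : E3 ↦ newtonKernel (x - y)) (volume.restrict (ball x R)) :=
    (measurable_newtonKernel.comp (measurable_id.const_sub x)).aestronglyMeasurable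
  have hΔm : AEStronglyMeasurable (Δ w) (volume.restrict (ball x R)) := hΔc.aestronglyMeasurable
  -- the integrand of the representation is dominated by `(Γ² + (Δw)²)/2`
  have hI3 : Integrable (fun y ↦ (newtonKernel (x - y) ^ 2 + ((Δ w) y) ^ 2) / 2)
      (volume.restrict (ball x R)) := (hI1.add hI2).div_const 2
  have hI12 : Integrable (fun y ↦ ‖newtonKernel (x - y) * (Δ w) y‖)
      (volume.restrict (ball x R)) := by
    refine Integrable.mono' hI3 (hKm.mul hΔm).norm (Eventually.of_forall fun y ↦ ?_)
    rw [norm_norm, norm_mul, Real.norm_eq_abs, Real.norm_eq_abs]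
    nlinarith [sq_nonneg (|newtonKernel (x - y)| - |(Δ w) y|), sq_abs (newtonKernel (x - y)),
      sq_abs ((Δ w) y)]
  set a : ℝ := ∫ y in ball x R, newtonKernel (x - y) ^ 2 with ha
  set bb : ℝ := ∫ y in ball x R, ((Δ w) y) ^ 2 with hbb
  have ha0 : 0 ≤ a := setIntegral_nonneg measurableSet_ball fun y _ ↦ sq_nonneg _
  have hbb0 : 0 ≤ bb := setIntegral_nonneg measurableSet_ball fun y _ ↦ sq_nonneg _
  -- Young's inequality for every `κ > 0`
  have hyoung : ∀ κ : ℝ, 0 < κ → |w x| ≤ κ / 2 * a + bb / (2 * κ) := by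
    intro κ hκ
    have hpt : ∀ y, ‖newtonKernel (x - y) * (Δ w) y‖ ≤
        κ / 2 * newtonKernel (x - y) ^ 2 + ((Δ w) y) ^ 2 / (2 * κ) := by
      intro y
      rw [norm_mul, Real.norm_eq_abs, Real.norm_eq_abs]
      have h2 : 2 * |newtonKernel (x - y)| * |(Δ w) y| ≤
          κ * |newtonKernel (x - y)| ^ 2 + |(Δ w) y| ^ 2 / κ := by
        have h : 0 ≤ (κ * |newtonKernel (x - y)| - |(Δ w) y|) ^ 2 / κ :=
          div_nonneg (sq_nonneg _) hκ.le
        have e : (κ * |newtonKernel (x - y)| - |(Δ w) y|) ^ 2 / κ =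
            κ * |newtonKernel (x - y)| ^ 2 + |(Δ w) y| ^ 2 / κ
              - 2 * |newtonKernel (x - y)| * |(Δ w) y| := by
          field_simp
          ring
        linarith
      rw [sq_abs, sq_abs] at h2
      have e2 : κ * newtonKernel (x - y) ^ 2 + ((Δ w) y) ^ 2 / κ =
          2 * (κ / 2 * newtonKernel (x - y) ^ 2 + ((Δ w) y) ^ 2 / (2 * κ)) := by
        ring
      linarith [h2, e2]
    have hIr : Integrable (fun y ↦ κ / 2 * newtonKernel (x - y) ^ 2 + ((Δ w) y) ^ 2 / (2 * κ))
        (volume.restrict (ball x R)) := (hI1.const_mul _).add (hI2.div_const _)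
    have s1 : |w x| = ‖∫ y in ball x R, newtonKernel (x - y) * (Δ w) y‖ := by
      rw [Real.norm_eq_abs, ← hloc, ← hrep]
    have s2 : ‖∫ y in ball x R, newtonKernel (x - y) * (Δ w) y‖ ≤
        ∫ y in ball x R, ‖newtonKernel (x - y) * (Δ w) y‖ := norm_integral_le_integral_norm _
    have s3 : ∫ y in ball x R, ‖newtonKernel (x - y) * (Δ w) y‖ ≤
        ∫ y in ball x R, (κ / 2 * newtonKernel (x - y) ^ 2 + ((Δ w) y) ^ 2 / (2 * κ)) :=
      integral_mono hI12 hIr hpt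
    have s4 : ∫ y in ball x R, (κ / 2 * newtonKernel (x - y) ^ 2 + ((Δ w) y) ^ 2 / (2 * κ)) =
        κ / 2 * a + bb / (2 * κ) := by
      rw [integral_add (hI1.const_mul _) (hI2.div_const _), integral_const_mul, integral_div]
    rw [s1]
    exact s2.trans (s3.trans_eq s4)
  have hsq := sq_le_mul_of_forall_young (abs_nonneg (w x)) ha0 hbb0 hyoung
  rw [sq_abs] at hsq
  -- evaluate `a` and bound `bb`
  have ha_eq : a = (16 * π ^ 2)⁻¹ * (R * c₂) := by
    rw [ha, ← integral_ball_norm_sub_rpow_neg_two x hRpos, ← integral_const_mul]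
    refine integral_congr_ae (Eventually.of_forall fun y ↦ ?_)
    exact newtonKernel_sq (x - y)
  have hbb_le : bb ≤ ∫ y, ((Δ w) y) ^ 2 :=
    setIntegral_le_integral hI2' (Eventually.of_forall fun y ↦ sq_nonneg _)
  have hfin := calc w x ^ 2 ≤ a * bb := hsq
    _ ≤ a * ∫ y, ((Δ w) y) ^ 2 := mul_le_mul_of_nonneg_left hbb_le ha0
    _ = 3 * c₂ / (16 * π ^ 2) * ρ * ∫ y, ((Δ w) y) ^ 2 := by
        rw [ha_eq, hR]
        ring
  convert hfin using 1

variable {ι : Type*} [Fintype ι] (b : OrthonormalBasis ι ℝ E3)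

/-- **Interior estimates on concentric balls of `ℝ³`, with the supremum bound.** There is
`M ≥ 1` such that for `U` open, `B̄(x₀,σ) ⊆ U` (`σ > 0`), `u ∈ C³(U)`, `G` continuous,
`0 ≤ ε ≤ 1/10` and
`|Δu| ≤ ε √(Σᵢⱼ(∂ⱼ∂ᵢu)²) + (M/σ) √(Σᵢ(∂ᵢu)²) + (M/σ)² |u| + G` on `B̄(x₀,σ)`:
with `L = M/σ`, `n = card ι` and `c₂ = ∫_{B₁} |u|⁻²`,
`∫_{B(x₀,σ/2)} Σᵢ(∂ᵢu)² ≤ 400(n+1)² L² ∫_{B̄} u² + 3 L⁻² ∫_{B̄} G²`,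
`∫_{B(x₀,σ/2)} Σᵢⱼ(∂ⱼ∂ᵢu)² ≤ 220000(n+1)³ L⁴ ∫_{B̄} u² + 1800(n+1) ∫_{B̄} G²`, and for
`x ∈ B̄(x₀,σ/2)`,
`u(x)² ≤ (3c₂/(16π²)) σ (46000(n+1)³ L⁴ ∫_{B̄} u² + 400(n+1) ∫_{B̄} G²)` — i.e.
`sup_{B_{σ/2}} |u| ≲ σ^{-3/2} ‖u‖_{L²(B_σ)} + σ^{1/2} ‖G‖_{L²(B_σ)}`, the scaled local maximum
estimate for classical solutions of equations close to the Laplacian in dimension three (the form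
in which Schoen–Yau, proof of Lemma 3.2, pass from the `L⁶` bound (3.5) to `v → 0` and to the
decay of the derivatives, (3.19)–(3.20)).
[cite: GilbargTrudinger2001, Thm. 8.17 and Thm. 9.20 (classical case); SchoenYauPMT1979, Lemma 3.2 (3.5)–(3.9)] -/
theorem ball_estimates_three :
    ∃ M : ℝ, 1 ≤ M ∧ ∀ (U : Set E3) (u G : E3 → ℝ) (x₀ : E3) (σ ε : ℝ),
      IsOpen U → closedBall x₀ σ ⊆ U → ContDiffOn ℝ 3 u U → 0 < σ → 0 ≤ ε → ε ≤ 1 / 10 →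
      Continuous G →
      (∀ x ∈ closedBall x₀ σ, |(Δ u) x| ≤
        ε * Real.sqrt (∑ i, ∑ j, (fderiv ℝ (fun y => fderiv ℝ u y (b i)) x (b j)) ^ 2)
          + M / σ * Real.sqrt (∑ i, (fderiv ℝ u x (b i)) ^ 2) + (M / σ) ^ 2 * |u x| + G x) →
      (∫ x in ball x₀ (σ / 2), ∑ i, (fderiv ℝ u x (b i)) ^ 2) ≤
          400 * ((Fintype.card ι : ℝ) + 1) ^ 2 * (M / σ) ^ 2 * (∫ x in closedBall x₀ σ, u x ^ 2)
            + 3 * (∫ x in closedBall x₀ σ, G x ^ 2) / (M / σ) ^ 2 ∧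
        (∫ x in ball x₀ (σ / 2), ∑ i, ∑ j, (fderiv ℝ (fun y => fderiv ℝ u y (b i)) x (b j)) ^ 2) ≤
          220000 * ((Fintype.card ι : ℝ) + 1) ^ 3 * (M / σ) ^ 4
              * (∫ x in closedBall x₀ σ, u x ^ 2)
            + 1800 * ((Fintype.card ι : ℝ) + 1) * ∫ x in closedBall x₀ σ, G x ^ 2 ∧
        ∀ x ∈ closedBall x₀ (σ / 2), u x ^ 2 ≤
          3 * (∫⁻ u in ball (0 : E3) 1, powKer 2 u).toReal / (16 * π ^ 2) * σ
            * (46000 * ((Fintype.card ι : ℝ) + 1) ^ 3 * (M / σ) ^ 4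
                * (∫ x in closedBall x₀ σ, u x ^ 2)
              + 400 * ((Fintype.card ι : ℝ) + 1) * ∫ x in closedBall x₀ σ, G x ^ 2) := by
  obtain ⟨M, hM1, hmain⟩ := ball_energy_estimates b
  refine ⟨M, hM1, fun U u G x₀ σ ε hU hKU hu hσ hε0 hε hG hΔ => ?_⟩
  obtain ⟨h1, h2, w, hw, hwc, hwS, hweq, hW⟩ := hmain U u G x₀ σ ε hU hKU hu hσ hε0 hε hG hΔ
  refine ⟨h1, h2, fun x hx => ?_⟩
  have hw2 : ContDiff ℝ 2 w := hw.of_le (by norm_num)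
  have hsq := sq_le_mul_integral_sq_laplacian hw2 hσ hwS x
  rw [hweq x hx] at hsq
  have hc : 0 ≤ 3 * (∫⁻ u in ball (0 : E3) 1, powKer 2 u).toReal / (16 * π ^ 2) * σ := by
    have : 0 ≤ (∫⁻ u in ball (0 : E3) 1, powKer 2 u).toReal := ENNReal.toReal_nonneg
    positivity
  exact hsq.trans (mul_le_mul_of_nonneg_left hW hc)


end Literature.Analysis.PDE
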